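import Literature.Geometry.Symplectic.OrigamiForm
import Literature.Geometry.Symplectic.GromovR4RelEndProofs

/-!
# The Pfaffian of a pulled-back 2-form: `Pf(α ∘ A) = det A · Pf α`

Helper file for item `FoldedSphereFoldExistence` (route SymplecticOrigami): the chart Pfaffian of
`Literature.Geometry.Symplectic.pfaffian` transforms under a linear change of frame `A : ℝ⁴ → ℝ⁴`
by the determinant, and vanishes on degenerate forms. Proof: `v ↦ α(v₀,v₁)α(v₂,v₃) -
α(v₀,v₂)α(v₁,v₃) + α(v₀,v₃)α(v₁,v₂)` is an alternating `4`-form on `ℝ⁴` (it is `½ α ∧ α`),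
hence a multiple of the determinant (`AlternatingMap.eq_smul_basis_det`).
-/

noncomputable section

-- the prescribed namespace `Summit.<P>.<Sub>.…` duplicates `SmoothPoincare4` (P = Sub)
set_option linter.dupNamespace false

open scoped Manifold ContDiff Topology
open Set Function
open Literature.Geometry.Symplectic

namespace Summit.SmoothPoincare4.SmoothPoincare4.Theorems.FoldedSphereFoldExistence

variable {E : Type*} [NormedAddCommGroup E] [NormedSpace ℝ E]

/-! ### Bilinearity of `2`-forms in the `![v, w]` spelling -/

/-- Additivity of a `2`-form in its first argument. [folklore] -/
theorem twoForm_add_left (α : E [⋀^Fin 2]→L[ℝ] ℝ) (x y w : E) :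
    α ![x + y, w] = α ![x, w] + α ![y, w] :=
  α.toContinuousMultilinearMap.cons_add _ _ _

/-- Homogeneity of a `2`-form in its first argument. [folklore] -/
theorem twoForm_smul_left (α : E [⋀^Fin 2]→L[ℝ] ℝ) (c : ℝ) (x w : E) :
    α ![c • x, w] = c * α ![x, w] :=
  α.toContinuousMultilinearMap.cons_smul _ _ _

/-- Antisymmetry of a `2`-form. [folklore] -/
theorem twoForm_swap (α : E [⋀^Fin 2]→L[ℝ] ℝ) (v w : E) : α ![v, w] = -α ![w, v] := by
  classical
  have h := α.map_swap ![w, v] (show (0 : Fin 2) ≠ 1 by decide)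
  have hs : (![w, v] ∘ Equiv.swap (0 : Fin 2) 1) = ![v, w] := by
    funext i
    fin_cases i <;> rfl
  rw [hs] at h
  exact h

/-- Additivity of a `2`-form in its second argument. [folklore] -/
theorem twoForm_add_right (α : E [⋀^Fin 2]→L[ℝ] ℝ) (v x y : E) :
    α ![v, x + y] = α ![v, x] + α ![v, y] := by
  rw [twoForm_swap α v, twoForm_add_left, twoForm_swap α v x, twoForm_swap α v y]
  ring

/-- Homogeneity of a `2`-form in its second argument. [folklore] -/
theorem twoForm_smul_right (α : E [⋀^Fin 2]→L[ℝ] ℝ) (c : ℝ) (v x : E) :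
    α ![v, c • x] = c * α ![v, x] := by
  rw [twoForm_swap α v, twoForm_smul_left, twoForm_swap α v x]
  ring

/-! ### The quartic form `½ α ∧ α` is an alternating `4`-form -/

/-- `½ (α ∧ α)(a,a,c,d) = 0`. [folklore] -/
theorem halfWedgeSq_eq_zero₀₁ (α : E [⋀^Fin 2]→L[ℝ] ℝ) (a c d : E) :
    α ![a, a] * α ![c, d] - α ![a, c] * α ![a, d] + α ![a, d] * α ![a, c] = 0 := by
  simp only [twoForm_apply_self]
  ring

/-- `½ (α ∧ α)(a,b,a,d) = 0`. [folklore] -/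
theorem halfWedgeSq_eq_zero₀₂ (α : E [⋀^Fin 2]→L[ℝ] ℝ) (a b d : E) :
    α ![a, b] * α ![a, d] - α ![a, a] * α ![b, d] + α ![a, d] * α ![b, a] = 0 := by
  simp only [twoForm_apply_self, twoForm_swap α b a]
  ring

/-- `½ (α ∧ α)(a,b,c,a) = 0`. [folklore] -/
theorem halfWedgeSq_eq_zero₀₃ (α : E [⋀^Fin 2]→L[ℝ] ℝ) (a b c : E) :
    α ![a, b] * α ![c, a] - α ![a, c] * α ![b, a] + α ![a, a] * α ![b, c] = 0 := by
  simp only [twoForm_apply_self, twoForm_swap α b a, twoForm_swap α c a]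
  ring

/-- `½ (α ∧ α)(a,b,b,d) = 0`. [folklore] -/
theorem halfWedgeSq_eq_zero₁₂ (α : E [⋀^Fin 2]→L[ℝ] ℝ) (a b d : E) :
    α ![a, b] * α ![b, d] - α ![a, b] * α ![b, d] + α ![a, d] * α ![b, b] = 0 := by
  simp only [twoForm_apply_self]
  ring

/-- `½ (α ∧ α)(a,b,c,b) = 0`. [folklore] -/
theorem halfWedgeSq_eq_zero₁₃ (α : E [⋀^Fin 2]→L[ℝ] ℝ) (a b c : E) :
    α ![a, b] * α ![c, b] - α ![a, c] * α ![b, b] + α ![a, b] * α ![b, c] = 0 := by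
  simp only [twoForm_apply_self, twoForm_swap α c b]
  ring

/-- `½ (α ∧ α)(a,b,c,c) = 0`. [folklore] -/
theorem halfWedgeSq_eq_zero₂₃ (α : E [⋀^Fin 2]→L[ℝ] ℝ) (a b c : E) :
    α ![a, b] * α ![c, c] - α ![a, c] * α ![b, c] + α ![a, c] * α ![b, c] = 0 := by
  simp only [twoForm_apply_self]
  ring

/-- **`½ α ∧ α` is an alternating `4`-form**: there is an alternating `4`-linear form whose value
on `v` is `α(v₀,v₁)α(v₂,v₃) - α(v₀,v₂)α(v₁,v₃) + α(v₀,v₃)α(v₁,v₂)` (stated as an existence so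
that no definition is added). [folklore] -/
theorem exists_alternatingMap_halfWedgeSq (α : E [⋀^Fin 2]→L[ℝ] ℝ) :
    ∃ f : E [⋀^Fin 4]→ₗ[ℝ] ℝ, ∀ v : Fin 4 → E, f v =
      α ![v 0, v 1] * α ![v 2, v 3] - α ![v 0, v 2] * α ![v 1, v 3]
        + α ![v 0, v 3] * α ![v 1, v 2] := by
  refine ⟨{ toFun := fun v => α ![v 0, v 1] * α ![v 2, v 3] - α ![v 0, v 2] * α ![v 1, v 3]
              + α ![v 0, v 3] * α ![v 1, v 2]
            map_update_add' := ?_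
            map_update_smul' := ?_
            map_eq_zero_of_eq' := ?_ }, fun v => rfl⟩
  · intro inst m i x y
    have hinst : inst = instDecidableEqFin 4 := Subsingleton.elim _ _
    subst hinst
    fin_cases i
    · simp [twoForm_add_left]
      ring
    · simp [twoForm_add_left, twoForm_add_right]
      ring
    · simp [twoForm_add_left, twoForm_add_right]
      ring
    · simp [twoForm_add_right]
      ring
  · intro inst m i c x
    have hinst : inst = instDecidableEqFin 4 := Subsingleton.elim _ _
    subst hinst
    fin_cases i
    · simp [twoForm_smul_left]
      ring
    · simp [twoForm_smul_left, twoForm_smul_right]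
      ring
    · simp [twoForm_smul_left, twoForm_smul_right]
      ring
    · simp [twoForm_smul_right]
      ring
  · intro v i j hij hne
    show α ![v ⟨0, by norm_num⟩, v ⟨1, by norm_num⟩] * α ![v ⟨2, by norm_num⟩, v ⟨3, by norm_num⟩]
        - α ![v ⟨0, by norm_num⟩, v ⟨2, by norm_num⟩] * α ![v ⟨1, by norm_num⟩, v ⟨3, by norm_num⟩]
        + α ![v ⟨0, by norm_num⟩, v ⟨3, by norm_num⟩] * α ![v ⟨1, by norm_num⟩, v ⟨2, by norm_num⟩]
        = 0
    fin_cases i <;> fin_cases j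
    all_goals first
      | exact absurd rfl hne
      | (beta_reduce at hij
         rw [hij]
         first
         | exact halfWedgeSq_eq_zero₀₁ α _ _ _
         | exact halfWedgeSq_eq_zero₀₂ α _ _ _
         | exact halfWedgeSq_eq_zero₀₃ α _ _ _
         | exact halfWedgeSq_eq_zero₁₂ α _ _ _
         | exact halfWedgeSq_eq_zero₁₃ α _ _ _
         | exact halfWedgeSq_eq_zero₂₃ α _ _ _)

/-! ### `Pf(α ∘ A) = det A · Pf α` on `ℝ⁴` -/

/-- `A ∘ (a, b) = (A a, A b)` for pairs of vectors. [folklore] -/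
theorem comp_vecTwo {X Y : Type*} (f : X → Y) (a b : X) : f ∘ ![a, b] = ![f a, f b] := by
  funext i
  fin_cases i <;> rfl

/-- **`Pf(α ∘ A) = det A · Pf α`**: the chart Pfaffian of a `2`-form on `ℝ⁴` pulled back along a
linear map `A` is the determinant of `A` times the Pfaffian (since `½ α ∧ α` is a top-degree
alternating form, `AlternatingMap.eq_smul_basis_det`). [folklore] -/
theorem pfaffian_compContinuousLinearMap (α : (EuclideanSpace ℝ (Fin 4)) [⋀^Fin 2]→L[ℝ] ℝ)
    (A : (EuclideanSpace ℝ (Fin 4)) →L[ℝ] EuclideanSpace ℝ (Fin 4)) :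
    pfaffian (α.compContinuousLinearMap A) =
      LinearMap.det (A : (EuclideanSpace ℝ (Fin 4)) →ₗ[ℝ] EuclideanSpace ℝ (Fin 4)) *
        pfaffian α := by
  obtain ⟨f, hf⟩ := exists_alternatingMap_halfWedgeSq α
  set b := EuclideanSpace.basisFun (Fin 4) ℝ with hb
  have h3 : (⇑b.toBasis : Fin 4 → EuclideanSpace ℝ (Fin 4)) = b := by
    funext i
    simp [hb]
  -- both Pfaffians are values of `f`
  have hPf : pfaffian α = f b := by
    rw [hf]
    simp only [hb, EuclideanSpace.basisFun_apply, pfaffian, stdVec]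
  have hPfA : pfaffian (α.compContinuousLinearMap A) = f (A ∘ b) := by
    rw [hf]
    simp only [hb, pfaffian, ContinuousAlternatingMap.compContinuousLinearMap_apply, comp_vecTwo,
      Function.comp_apply, EuclideanSpace.basisFun_apply, stdVec]
  rw [hPfA, hPf]
  have key := AlternatingMap.eq_smul_basis_det b.toBasis f
  have h1 : f (A ∘ b) = (f b.toBasis • b.toBasis.det) (A ∘ b) := by
    rw [← key]
  rw [h1, AlternatingMap.smul_apply, smul_eq_mul]
  have h2 : b.toBasis.det ((A : (EuclideanSpace ℝ (Fin 4)) →ₗ[ℝ] EuclideanSpace ℝ (Fin 4)) ∘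
      b.toBasis) = LinearMap.det (A : (EuclideanSpace ℝ (Fin 4)) →ₗ[ℝ] EuclideanSpace ℝ (Fin 4))
        * b.toBasis.det b.toBasis :=
    Module.Basis.det_comp b.toBasis _ b.toBasis
  rw [Module.Basis.det_self, mul_one, h3] at h2
  have h4 : (A : EuclideanSpace ℝ (Fin 4) → EuclideanSpace ℝ (Fin 4)) ∘ b =
      ((A : (EuclideanSpace ℝ (Fin 4)) →ₗ[ℝ] EuclideanSpace ℝ (Fin 4)) :
        EuclideanSpace ℝ (Fin 4) → EuclideanSpace ℝ (Fin 4)) ∘ b := rfl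
  rw [h4, h2, h3]
  ring

/-- **A degenerate `2`-form on `ℝ⁴` has vanishing Pfaffian**: if `v ≠ 0` pairs to zero with every
vector, then substituting `v = Σ vₖ eₖ` in the `k`-th slot of `½ α ∧ α` gives
`vₖ · Pf α = ½ (α ∧ α)(…, v, …) = 0` (every term has a factor `α(v, ·)`), and some `vₖ ≠ 0`.
[folklore] -/
theorem pfaffian_eq_zero_of_degenerate (α : (EuclideanSpace ℝ (Fin 4)) [⋀^Fin 2]→L[ℝ] ℝ)
    {v : EuclideanSpace ℝ (Fin 4)} (hv : v ≠ 0) (hker : ∀ w, α ![v, w] = 0) :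
    pfaffian α = 0 := by
  classical
  obtain ⟨f, hf⟩ := exists_alternatingMap_halfWedgeSq α
  set b := EuclideanSpace.basisFun (Fin 4) ℝ with hb
  have hPf : pfaffian α = f b := by
    rw [hf]
    simp only [hb, EuclideanSpace.basisFun_apply, pfaffian, stdVec]
  have hker' : ∀ w, α ![w, v] = 0 := fun w => by rw [twoForm_swap, hker, neg_zero]
  -- substituting `v` in the `k`-th slot kills the form
  have hzero : ∀ k : Fin 4, f (Function.update (⇑b) k v) = 0 := by
    intro k
    rw [hf]
    fin_cases k
    · simp [hker]
    · simp [hker, hker']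
    · simp [hker, hker']
    · simp [hker']
  -- linearity in the `k`-th slot: `f (update b k v) = v k * Pf α`
  have hlin : ∀ k : Fin 4, f (Function.update (⇑b) k v) = v k * pfaffian α := by
    intro k
    set L := f.toMultilinearMap.toLinearMap (⇑b) k with hL
    have hLx : ∀ x, L x = f (Function.update (⇑b) k x) := fun x => rfl
    have hv' : v = ∑ i, v i • b i := by
      conv_lhs => rw [← b.sum_repr v]
      simp [hb]
    rw [← hLx, hv', map_sum]
    simp only [map_smul]
    simp only [hLx, smul_eq_mul]
    have hterm : ∀ i, f (Function.update (⇑b) k (b i)) = if i = k then pfaffian α else 0 := by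
      intro i
      split_ifs with hik
      · subst hik
        rw [Function.update_eq_self, hPf]
      · exact f.map_update_self (⇑b) (Ne.symm hik)
    simp only [hterm, mul_ite, mul_zero, Finset.sum_ite_eq', Finset.mem_univ, if_true]
    congr 1
    rw [← hv']
  -- some coordinate of `v` is non-zero
  obtain ⟨k, hk⟩ : ∃ k, v k ≠ 0 := by
    by_contra h
    push Not at h
    exact hv (by ext i; simpa using h i)
  have h := (hlin k).symm.trans (hzero k)
  exact (mul_eq_zero.1 h).resolve_left hk

end Summit.SmoothPoincare4.SmoothPoincare4.Theorems.FoldedSphereFoldExistence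

end
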